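import Literature.Computability.Complexity.SymPlusProofs
import Literature.Computability.Complexity.ACRealizeOver
import HarnessLib

/-!
# Bounding the fan-in of `ACC` circuits: repeated argument wires are redundant

Fourth file of the third layer under the named fact `Williams2014_thm_3_2`
(`Williams2014Transfer.lean`; R. Williams, *Nonuniform ACC circuit lower bounds*, J. ACM 61
(2014), Thm. 3.2 / proof of Thm. 1.1). The hypothesis format `AccSatInTime d m s T` of Williams'
transfer theorem (`Williams2014.lean`) bounds the SAT instances handed to the `ACC`-SAT
algorithm in gates AND in fan-in (`Circuit.maxFanIn ≤ s n`: Williams measures size by WIRES,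
p. 5), whereas the existence statements that feed it — `AccSimulation`,
`HasSuccinctAccAssignments` (`Williams2014AccWitnesses.lean`), the circuit `D` of
`Williams2014WitnessCheck.lean` — come from `ACC0`, whose circuits are bounded in gates only
(`DepthSizeClass`). In the tree's circuit model a gate `∧ₖ`/`∨ₖ`/`MODₘ,ₖ` may read the same
wire many times, so a circuit with few gates can have enormous fan-in. This file removes the
gap once and for all: **every circuit over `accBasis m` (`0 < m`) on `n` inputs with `s` gates
is equivalent to one with the same gates count, no larger `acDepth`, and fan-in
`≤ m · (n + s)`** (`Circuit.exists_normFanIn`) — for `∧`/`∨` gates keep each distinct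
argument wire once, for `MODₘ` gates keep it with its multiplicity reduced modulo `m` (the
number of true arguments then changes by a multiple of `m`), leave `¬` gates alone; a gate at
position `j` reads at most `n + j` distinct wires.

* `reduceMod m l` — a list with the multiplicity of every element of `l` reduced mod `m`;
  `countP_reduceMod_mod` — counts agree mod `m`;
* `Gate.normFanIn m g` — the normalised gate; `Gate.normFanIn_op` (same value on every wire
  valuation), `Gate.normFanIn_fn_mem` (still in `accBasis m`), `Gate.acWeight_normFanIn_le`,
  `Gate.range_normFanIn_subset` (reads only wires the old gate read),
  `Gate.arity_normFanIn_le` (fan-in `≤ m (n + j) + 1` at position `j`);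
* `GateList.vals_map_normFanIn`, `GateList.getD_wdepths_map_normFanIn_le` — the normalised
  program computes the same wire values and no larger depths;
* `Circuit.exists_normFanIn` — the circuit-level statement above (all proved).

Williams does not need this step (his size counts wires from the start); it is bookkeeping
forced by the tree's gate-count `ACC0` versus the wire-count instances of `AccSatInTime`
(cf. the faithfulness notes of `Williams2014.lean`).

## References

* R. Williams, *Nonuniform ACC circuit lower bounds*, J. ACM 61(1) (2014) 2:1–2:32, §2
  (p. 5: "The size of a circuit refers to the number of wires in it … the distinction between
  the number of wires and gates does not matter") [Williams2014].
* H. Vollmer, *Introduction to Circuit Complexity*, Springer 1999, §1.1 (gates `∧`, `∨`,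
  `MODₘ` as functions of the multiset of their inputs) [Vollmer1999].
-/

namespace Literature.Computability.Complexity

open Finset GateList BT

/-! ### Counting helpers -/

/-- `foldr max 0` is bounded by any common bound of the entries. [folklore] -/
theorem foldr_max_zero_le {l : List ℕ} {b : ℕ} (h : ∀ a ∈ l, a ≤ b) : l.foldr max 0 ≤ b := by
  induction l with
  | nil => exact Nat.zero_le _
  | cons a l ih =>
    simp only [List.foldr_cons]
    exact max_le (h a List.mem_cons_self) (ih fun x hx => h x (List.mem_cons_of_mem _ hx))

/-- The fan-in of a circuit is bounded by any common bound of the arities of its gates.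
[folklore] -/
theorem Circuit.maxFanIn_le_of_forall {ι : Type*} (C : Circuit ι) {b : ℕ}
    (h : ∀ g ∈ C.gates, g.arity ≤ b) : C.maxFanIn ≤ b :=
  foldr_max_zero_le fun a ha => by
    obtain ⟨g, hg, rfl⟩ := List.mem_map.1 ha
    exact h g hg

/-- Summing the indicator of a Boolean predicate over a list counts it. [folklore] -/
theorem sum_map_boole_eq_countP {W : Type*} (l : List W) (u : W → Bool) :
    (l.map fun w => if u w = true then 1 else 0).sum = l.countP u := by
  induction l with
  | nil => simp
  | cons a l ih =>
    rw [List.map_cons, List.sum_cons, List.countP_cons, ih]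
    exact Nat.add_comm _ _

/-- Filtering then summing is summing the guarded terms. [folklore] -/
theorem sum_map_filter_eq_sum_map_ite {W : Type*} (l : List W) (u : W → Bool) (f : W → ℕ) :
    ((l.filter u).map f).sum = (l.map fun w => if u w = true then f w else 0).sum := by
  induction l with
  | nil => simp
  | cons a l ih =>
    rw [List.filter_cons, List.map_cons, List.sum_cons]
    cases h : u a <;> simp [ih]

/-- **The number of true arguments of a gate is a count over its argument list.** [folklore] -/
theorem numOnes_comp_eq_countP_ofFn {W : Type*} {k : ℕ} (args : Fin k → W) (u : W → Bool) :
    GateFn.numOnes (fun a => u (args a)) = (List.ofFn args).countP u := by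
  unfold GateFn.numOnes
  rw [Finset.card_filter, ← sum_map_boole_eq_countP, List.map_ofFn, List.sum_ofFn]
  rfl

/-- The same for a family indexed by the positions of a list. [folklore] -/
theorem numOnes_getElem_eq_countP {W : Type*} (l : List W) (u : W → Bool) :
    GateFn.numOnes (fun a : Fin l.length => u l[(a : ℕ)]) = l.countP u := by
  have h := numOnes_comp_eq_countP_ofFn (fun a : Fin l.length => l[(a : ℕ)]) u
  rw [List.ofFn_getElem] at h
  exact h

/-- Sums of termwise congruent lists are congruent. [folklore] -/
theorem sum_map_mod_congr {W : Type*} (L : List W) (m : ℕ) {f₁ f₂ : W → ℕ}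
    (h : ∀ w ∈ L, f₁ w % m = f₂ w % m) : (L.map f₁).sum % m = (L.map f₂).sum % m := by
  induction L with
  | nil => rfl
  | cons a L ih =>
    simp only [List.map_cons, List.sum_cons]
    rw [Nat.add_mod, ih (fun w hw => h w (List.mem_cons_of_mem _ hw)), h a List.mem_cons_self,
      ← Nat.add_mod]

/-! ### Reducing multiplicities modulo `m` -/

section Reduce

variable {W : Type*} [DecidableEq W]

/-- The list `l` with the multiplicity of each of its elements reduced modulo `m` (elements in
the order of first occurrence). [folklore] -/
def reduceMod (m : ℕ) (l : List W) : List W :=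
  l.dedup.flatMap fun w => List.replicate (l.count w % m) w

/-- Elements of `reduceMod m l` are elements of `l`. [folklore] -/
theorem mem_of_mem_reduceMod {m : ℕ} {l : List W} {w : W} (h : w ∈ reduceMod m l) : w ∈ l := by
  simp only [reduceMod, List.mem_flatMap, List.mem_replicate] at h
  obtain ⟨w', hw', -, rfl⟩ := h
  exact List.mem_dedup.1 hw'

/-- `reduceMod m l` has at most `m` copies of each of the `|l.dedup|` distinct elements.
[folklore] -/
theorem length_reduceMod_le {m : ℕ} (hm : 0 < m) (l : List W) :
    (reduceMod m l).length ≤ l.dedup.length * m := by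
  rw [reduceMod, List.length_flatMap]
  refine (List.sum_le_card_nsmul _ m fun x hx => ?_).trans (by simp)
  obtain ⟨w, -, rfl⟩ := List.mem_map.1 hx
  simpa using (Nat.mod_lt _ hm).le

/-- **Counts agree modulo `m`**: for every Boolean predicate `u`, the number of elements of
`reduceMod m l` satisfying `u` is congruent mod `m` to that of `l`. [folklore] -/
theorem countP_reduceMod_mod (m : ℕ) (l : List W) (u : W → Bool) :
    (reduceMod m l).countP u % m = l.countP u % m := by
  have h1 : (reduceMod m l).countP u =
      (l.dedup.map fun w => if u w = true then l.count w % m else 0).sum := by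
    rw [reduceMod, List.countP_flatMap]
    congr 1
    refine List.map_congr_left fun w _ => ?_
    simp [List.countP_replicate]
  have h2 : l.countP u = (l.dedup.map fun w => if u w = true then l.count w else 0).sum := by
    rw [← List.sum_map_count_dedup_filter_eq_countP u l, sum_map_filter_eq_sum_map_ite]
  rw [h1, h2]
  exact sum_map_mod_congr _ m fun w _ => by by_cases hw : u w = true <;> simp [hw]

end Reduce

/-! ### The normalised gate -/

namespace Gate

variable {ι : Type*}

/-- The gate with truth tables `G k` (one per arity) reading the wires of the list `ws` in
order. [folklore] -/
def ofList (G : ∀ k : ℕ, (Fin k → Bool) → Bool) (ws : List (ι ⊕ ℕ)) : Gate ι :=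
  ⟨ws.length, G ws.length, fun a => ws[(a : ℕ)]⟩

variable [DecidableEq ι]

/-- **Fan-in normalisation of a gate over `accBasis m`**: a conjunction / disjunction keeps each
distinct argument wire once, a `MODₘ` gate keeps it with multiplicity reduced modulo `m`, any
other gate (negations; gates outside the basis) is unchanged. [folklore] -/
def normFanIn (m : ℕ) (g : Gate ι) : Gate ι :=
  if accCode m g.fn = 1 then ofList (fun k => (GateFn.and k).2) (List.ofFn g.args).dedup
  else if accCode m g.fn = 2 then ofList (fun k => (GateFn.or k).2) (List.ofFn g.args).dedup
  else if accCode m g.fn = 3 then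
    ofList (fun k => (GateFn.modGate m k).2) (reduceMod m (List.ofFn g.args))
  else g

/-- The four cases of the symbolic code. [folklore] -/
theorem accCode_cases (m : ℕ) (f : GateFn) : accCode m f = 1 ∨ accCode m f = 2 ∨ accCode m f = 3 ∨
    (accCode m f ≠ 1 ∧ accCode m f ≠ 2 ∧ accCode m f ≠ 3) := by
  omega

/-- Code `1`: the normalised gate is the conjunction of the distinct argument wires. [folklore] -/
theorem normFanIn_of_eq_one {m : ℕ} {g : Gate ι} (h : accCode m g.fn = 1) :
    g.normFanIn m = ofList (fun k => (GateFn.and k).2) (List.ofFn g.args).dedup := by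
  unfold normFanIn; rw [if_pos h]

/-- Code `2`: the normalised gate is the disjunction of the distinct argument wires. [folklore] -/
theorem normFanIn_of_eq_two {m : ℕ} {g : Gate ι} (h : accCode m g.fn = 2) :
    g.normFanIn m = ofList (fun k => (GateFn.or k).2) (List.ofFn g.args).dedup := by
  unfold normFanIn; rw [if_neg (by omega), if_pos h]

/-- Code `3`: the normalised gate is `MODₘ` of the argument wires reduced mod `m`. [folklore] -/
theorem normFanIn_of_eq_three {m : ℕ} {g : Gate ι} (h : accCode m g.fn = 3) :
    g.normFanIn m = ofList (fun k => (GateFn.modGate m k).2) (reduceMod m (List.ofFn g.args)) := by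
  unfold normFanIn; rw [if_neg (by omega), if_neg (by omega), if_pos h]

/-- Other codes: the gate is unchanged. [folklore] -/
theorem normFanIn_of_ne {m : ℕ} {g : Gate ι} (h1 : accCode m g.fn ≠ 1) (h2 : accCode m g.fn ≠ 2)
    (h3 : accCode m g.fn ≠ 3) : g.normFanIn m = g := by
  unfold normFanIn; rw [if_neg h1, if_neg h2, if_neg h3]

/-- The normalised gate reads only wires the gate read. [folklore] -/
theorem range_normFanIn_subset (m : ℕ) (g : Gate ι) :
    Set.range (g.normFanIn m).args ⊆ Set.range g.args := by
  rcases accCode_cases m g.fn with h | h | h | ⟨h1, h2, h3⟩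
  · rw [normFanIn_of_eq_one h]
    rintro w ⟨a', rfl⟩
    exact List.mem_ofFn.1 (List.mem_dedup.1 (List.getElem_mem _))
  · rw [normFanIn_of_eq_two h]
    rintro w ⟨a', rfl⟩
    exact List.mem_ofFn.1 (List.mem_dedup.1 (List.getElem_mem _))
  · rw [normFanIn_of_eq_three h]
    rintro w ⟨a', rfl⟩
    exact List.mem_ofFn.1 (mem_of_mem_reduceMod (List.getElem_mem _))
  · rw [normFanIn_of_ne h1 h2 h3]

/-- Pointwise form: every argument wire of the normalised gate is an argument wire of the gate.
[folklore] -/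
theorem exists_arg_eq_of_normFanIn (m : ℕ) (g : Gate ι) (a' : Fin (g.normFanIn m).arity) :
    ∃ a, g.args a = (g.normFanIn m).args a' :=
  g.range_normFanIn_subset m ⟨a', rfl⟩

/-- The normalised gate of a gate of `accBasis m` is in `accBasis m`. [folklore] -/
theorem normFanIn_fn_mem {m : ℕ} {g : Gate ι} (hg : g.fn ∈ accBasis m) :
    (g.normFanIn m).fn ∈ accBasis m := by
  rcases accCode_cases m g.fn with h | h | h | ⟨h1, h2, h3⟩
  · rw [normFanIn_of_eq_one h]; exact acBasis_subset_accBasis m (and_mem_acBasis _)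
  · rw [normFanIn_of_eq_two h]; exact acBasis_subset_accBasis m (or_mem_acBasis _)
  · rw [normFanIn_of_eq_three h]; exact Or.inr (Set.mem_iUnion.2 ⟨_, rfl⟩)
  · rw [normFanIn_of_ne h1 h2 h3]; exact hg

/-- Normalisation does not increase the `acWeight` (it maps negations to themselves).
[folklore] -/
theorem acWeight_normFanIn_le (m : ℕ) (g : Gate ι) : acWeight (g.normFanIn m).fn ≤ acWeight g.fn := by
  rcases accCode_cases m g.fn with h | h | h | ⟨h1, h2, h3⟩
  · rw [acWeight_eq_one_of_accCode_ne (f := g.fn) (m := m) (by omega)]; exact acWeight_le_one _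
  · rw [acWeight_eq_one_of_accCode_ne (f := g.fn) (m := m) (by omega)]; exact acWeight_le_one _
  · rw [acWeight_eq_one_of_accCode_ne (f := g.fn) (m := m) (by omega)]; exact acWeight_le_one _
  · rw [normFanIn_of_ne h1 h2 h3]

/-- **The normalised gate computes the same value** on every valuation `u` of the wires
(conjunction/disjunction depend on the set of argument wires, `MODₘ` on their multiplicities
mod `m`; Vollmer 1999, §1.1). [cite: Vollmer1999, §1.1] -/
theorem normFanIn_op (m : ℕ) (g : Gate ι) (u : ι ⊕ ℕ → Bool) :
    (g.normFanIn m).op (fun a => u ((g.normFanIn m).args a)) = g.op fun a => u (g.args a) := by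
  rcases accCode_cases m g.fn with h | h | h | ⟨h1, h2, h3⟩
  · rw [normFanIn_of_eq_one h, op_and_of_accCode h]
    change decide (∀ a : Fin (List.ofFn g.args).dedup.length,
      u ((List.ofFn g.args).dedup[(a : ℕ)]) = true) = _
    rw [decide_eq_decide]
    constructor
    · intro hall a
      obtain ⟨i, hi, heq⟩ := List.getElem_of_mem
        (List.mem_dedup.2 (List.mem_ofFn.2 ⟨a, rfl⟩) : g.args a ∈ (List.ofFn g.args).dedup)
      rw [← heq]
      exact hall ⟨i, hi⟩
    · intro hall a
      obtain ⟨i, hi⟩ := List.mem_ofFn.1 (List.mem_dedup.1 (List.getElem_mem a.2) :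
        (List.ofFn g.args).dedup[(a : ℕ)] ∈ List.ofFn g.args)
      rw [← hi]
      exact hall i
  · rw [normFanIn_of_eq_two h, op_or_of_accCode h]
    change decide (∃ a : Fin (List.ofFn g.args).dedup.length,
      u ((List.ofFn g.args).dedup[(a : ℕ)]) = true) = _
    rw [decide_eq_decide]
    constructor
    · rintro ⟨a, ha⟩
      obtain ⟨i, hi⟩ := List.mem_ofFn.1 (List.mem_dedup.1 (List.getElem_mem a.2) :
        (List.ofFn g.args).dedup[(a : ℕ)] ∈ List.ofFn g.args)
      exact ⟨i, by rw [hi]; exact ha⟩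
    · rintro ⟨a, ha⟩
      obtain ⟨i, hi, heq⟩ := List.getElem_of_mem
        (List.mem_dedup.2 (List.mem_ofFn.2 ⟨a, rfl⟩) : g.args a ∈ (List.ofFn g.args).dedup)
      exact ⟨⟨i, hi⟩, by change u ((List.ofFn g.args).dedup[i]) = true; rw [heq]; exact ha⟩
  · rw [normFanIn_of_eq_three h, op_mod_of_accCode h]
    change decide (GateFn.numOnes (fun a : Fin (reduceMod m (List.ofFn g.args)).length =>
      u ((reduceMod m (List.ofFn g.args))[(a : ℕ)])) % m ≠ 0) = _
    rw [numOnes_getElem_eq_countP, numOnes_comp_eq_countP_ofFn, countP_reduceMod_mod]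
  · rw [normFanIn_of_ne h1 h2 h3]

/-- **Fan-in after normalisation**: a gate of `accBasis m` (`0 < m`) placed at position `j` of a
program on the inputs `Fin n` — so that it reads only inputs and the gates `< j` — normalises
to a gate of arity `≤ m (n + j) + 1` (`∧`/`∨`: at most `n + j` distinct wires; `MODₘ`: each at
most `m - 1` times; `¬`: one wire). [folklore] -/
theorem arity_normFanIn_le {n m j : ℕ} (hm : 0 < m) {g : Gate (Fin n)} (hg : g.fn ∈ accBasis m)
    (hj : GateOK j g) : (g.normFanIn m).arity ≤ m * (n + j) + 1 := by
  -- the distinct argument wires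
  have hds : (List.ofFn g.args).dedup.length ≤ n + j := by
    rw [← List.toFinset_card_of_nodup (List.nodup_dedup _)]
    have hsub : (List.ofFn g.args).dedup.toFinset ⊆
        (univ : Finset (Fin n)).map ⟨Sum.inl, Sum.inl_injective⟩ ∪
          (range j).map ⟨Sum.inr, Sum.inr_injective⟩ := by
      intro w hw
      rw [List.mem_toFinset, List.mem_dedup, List.mem_ofFn] at hw
      obtain ⟨a, rfl⟩ := hw
      cases ha : g.args a with
      | inl i => exact mem_union_left _ (mem_map.2 ⟨i, mem_univ _, rfl⟩)
      | inr m' => exact mem_union_right _ (mem_map.2 ⟨m', mem_range.2 (hj a m' ha), rfl⟩)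
    refine (card_le_card hsub).trans ((card_union_le _ _).trans ?_)
    simp
  have hmn : n + j ≤ m * (n + j) := Nat.le_mul_of_pos_left _ hm
  rcases accCode_cases m g.fn with h | h | h | ⟨h1, h2, h3⟩
  · rw [normFanIn_of_eq_one h]; exact hds.trans (hmn.trans (Nat.le_succ _))
  · rw [normFanIn_of_eq_two h]; exact hds.trans (hmn.trans (Nat.le_succ _))
  · rw [normFanIn_of_eq_three h]
    refine (length_reduceMod_le hm _).trans ?_
    calc (List.ofFn g.args).dedup.length * m ≤ (n + j) * m := Nat.mul_le_mul_right m hds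
      _ = m * (n + j) := Nat.mul_comm _ _
      _ ≤ m * (n + j) + 1 := Nat.le_succ _
  · rw [normFanIn_of_ne h1 h2 h3]
    have h0 : accCode m g.fn = 0 := by have := accCode_le_three hg; omega
    have hfn := fn_eq_not_of_accCode h0
    have h1' : g.arity = 1 := congrArg Sigma.fst hfn
    omega

end Gate

/-! ### The normalised program -/

namespace GateList

variable {ι : Type*}

/-- Pointwise smaller depths give smaller wire depths. [folklore] -/
theorem wireDepthOf_le_of_getD_le {ds ds' : List ℕ} (h : ∀ j, ds'.getD j 0 ≤ ds.getD j 0)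
    (u : ι ⊕ ℕ) : wireDepthOf ds' u ≤ wireDepthOf ds u := by
  cases u with
  | inl i => simp
  | inr j => simpa using h j

variable [DecidableEq ι]

/-- Normalising every gate keeps the program well formed. [folklore] -/
theorem wf_map_normFanIn (m : ℕ) {gs : List (Gate ι)} (h : WF gs) :
    WF (gs.map (Gate.normFanIn m)) := by
  intro j g' hg' a' m' ha'
  rw [List.getElem?_map] at hg'
  cases hj : gs[j]? with
  | none => rw [hj] at hg'; cases hg'
  | some g =>
    rw [hj] at hg'
    simp only [Option.map_some, Option.some.injEq] at hg'
    subst hg'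
    obtain ⟨a, ha⟩ := Gate.exists_arg_eq_of_normFanIn m g a'
    exact h j g hj a m' (by rw [ha, ha'])

/-- **The normalised program computes the same wire values.** [folklore] -/
theorem vals_map_normFanIn (m : ℕ) (x : ι → Bool) :
    ∀ gs : List (Gate ι), vals (gs.map (Gate.normFanIn m)) x = vals gs x := by
  intro gs
  induction gs using List.reverseRecOn with
  | nil => rfl
  | append_singleton gs g ih =>
    rw [List.map_append, List.map_singleton, vals_append_singleton, vals_append_singleton, ih,
      Gate.normFanIn_op m g (wireOf x (vals gs x))]

/-- **The normalised program has no larger depths** (gate by gate, for the `acWeight`).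
[folklore] -/
theorem getD_wdepths_map_normFanIn_le (m : ℕ) :
    ∀ (gs : List (Gate ι)) (j : ℕ),
      (wdepths acWeight (gs.map (Gate.normFanIn m))).getD j 0 ≤ (wdepths acWeight gs).getD j 0 := by
  intro gs
  induction gs using List.reverseRecOn with
  | nil => intro j; simp
  | append_singleton gs g ih =>
    intro j
    rw [List.map_append, List.map_singleton, wdepths_append_singleton, wdepths_append_singleton]
    rcases lt_trichotomy j gs.length with hj | rfl | hj
    · rw [List.getD_append _ _ _ _ (by simpa using hj), List.getD_append _ _ _ _ (by simpa using hj)]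
      exact ih j
    · rw [List.getD_append_right _ _ _ _ (by simp), List.getD_append_right _ _ _ _ (by simp)]
      simp only [length_wdepths, List.length_map, Nat.sub_self, List.getD_cons_zero]
      refine Nat.add_le_add (Gate.acWeight_normFanIn_le m g) (Finset.sup_le fun a' _ => ?_)
      obtain ⟨a, ha⟩ := Gate.exists_arg_eq_of_normFanIn m g a'
      rw [← ha]
      refine le_trans ?_ (Finset.le_sup (f := fun a => wireDepthOf (wdepths acWeight gs) (g.args a))
        (mem_univ a))
      cases g.args a with
      | inl i => simp
      | inr m' => simpa using ih m'
    · rw [List.getD_eq_default _ _ (by simp; omega), List.getD_eq_default _ _ (by simp; omega)]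

end GateList

/-! ### The circuit-level statement -/

/-- **Fan-in normalisation of `ACC` circuits**: every circuit over `accBasis m` (`0 < m`) on `n`
inputs is equivalent to a circuit over `accBasis m` with the same number of gates, no larger
`acDepth`, and every gate of fan-in at most `m · (n + size)` — so that gate-bounded `ACC`
circuits (the tree's `ACC0`) become wire-bounded instances as required by `AccSatInTime`
(Williams 2014, p. 5: for circuits with polynomially many gates "the distinction between the
number of wires and gates does not matter"). [cite: Williams2014, §2 (p. 5)] -/
theorem Circuit.exists_normFanIn {n m : ℕ} (hm : 0 < m) (C : Circuit (Fin n))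
    (hC : C.IsOver (accBasis m)) :
    ∃ C' : Circuit (Fin n), C'.IsOver (accBasis m) ∧ C'.size = C.size ∧ C'.acDepth ≤ C.acDepth ∧
      C'.maxFanIn ≤ m * (n + C.size) ∧ ∀ x, C'.eval x = C.eval x := by
  classical
  set gs' := C.gates.map (Gate.normFanIn m) with hgs'
  have hwf' : WF gs' := wf_map_normFanIn m (wf_gates C)
  have hlen : gs'.length = C.size := by simp [hgs', Circuit.size]
  have ho' : ∀ m', C.output = .inr m' → m' < gs'.length := fun m' h => by
    rw [hlen]; exact C.wf_output m' h
  refine ⟨GateList.toCircuit gs' C.output hwf' ho', ?_, hlen, ?_, ?_, fun x => ?_⟩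
  · intro g' hg'
    change g' ∈ gs' at hg'
    obtain ⟨g, hg, rfl⟩ := List.mem_map.1 hg'
    exact Gate.normFanIn_fn_mem (hC g hg)
  · change Circuit.depthWith _ acWeight ≤ Circuit.depthWith _ acWeight
    rw [circuit_depthWith, circuit_depthWith]
    exact wireDepthOf_le_of_getD_le (getD_wdepths_map_normFanIn_le m C.gates) C.output
  · refine Circuit.maxFanIn_le_of_forall _ fun g' hg' => ?_
    change g' ∈ gs' at hg'
    obtain ⟨g, hg, rfl⟩ := List.mem_map.1 hg'
    obtain ⟨j, hj, rfl⟩ := List.mem_iff_getElem.1 hg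
    have hok : GateOK j C.gates[j] := wf_gates C j _ (List.getElem?_eq_getElem hj)
    refine (Gate.arity_normFanIn_le hm (hC _ (List.getElem_mem hj)) hok).trans ?_
    have : j + 1 ≤ C.size := hj
    calc m * (n + j) + 1 ≤ m * (n + j) + m := Nat.add_le_add_left hm _
      _ = m * (n + (j + 1)) := by ring
      _ ≤ m * (n + C.size) := Nat.mul_le_mul_left m (Nat.add_le_add_left this n)
  · rw [circuit_eval, circuit_eval]
    change wireOf x (vals gs' x) C.output = wireOf x (vals C.gates x) C.output
    rw [hgs', vals_map_normFanIn]

end Literature.Computability.Complexity
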